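import Summits.CriticalPhenomena.CardyFormulaZ2.Theorems.HalfPlaneMarkDensityLaw.Negative.MarkEvents

/-!
# Multiscale block selection for the "few boundary touches" lemma (line `Sketch`, stub `block_select`)

Support file for the crux `HalfPlaneMarkDensityLaw` (stmt-CriticalPhenomena-5661), line `Sketch`,
self-duality programme, Stage II.  Pure combinatorics on a finite set `T ⊆ ℤ` (the abscissae where a
crossing cluster touches the target arc): given level thresholds `θ j ≥ 0` and diameter bounds
`D (j+1) ≥ M · θ (j+1)`, a nonempty `T` with at most `M + 1` elements has, at some level `j ≤ M`, an
initial segment ending at `t' ∈ T` of diameter `t' - min T ≤ D (j+1)` whose external gap (distance to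
the next element of `T`) is at least `θ j` (`block_select`, registered form).

The proof is a downward scan with a level counter: the state is a level `j`, a block end `b ∈ T` whose
external gap is `≥ θ j`, and a scan pointer `p ≤ b` with the potential bound
`(b - p) + #{u ∈ T | u < p} · θ (j+1) ≤ D (j+1)`.  If `b - min T ≤ D (j+1)` we stop; otherwise the
predecessor `q` of `p` in `T` exists, and either `p - q ≥ θ (j+1)` (descend: new state `(j+1, q, q)`)
or `p - q < θ (j+1)` (keep scanning: new state `(j, b, q)`); the number of elements of `T` below the
pointer strictly decreases, and `j + #{u ∈ T | u < b} ≤ M` is preserved, which bounds the level.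
The antitonicity hypothesis `θ (j+1) ≤ θ j` of the registered signature is not needed.
-/

noncomputable section

namespace Summit.CriticalPhenomena.CardyFormulaZ2.Cruxes.HalfPlaneMarkDensityLaw.SketchLine.SelfDual

open Finset

/-- Strict growth of a filter of `T : Finset ℤ` along an implication of predicates witnessed to be
strict by an element of `T`. -/
private theorem card_filter_lt_card_filter (T : Finset ℤ) (P Q : ℤ → Prop) [DecidablePred P]
    [DecidablePred Q] (hPQ : ∀ x ∈ T, P x → Q x) (x : ℤ) (hx : x ∈ T) (hQx : Q x) (hPx : ¬ P x) :
    (T.filter P).card < (T.filter Q).card := by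
  refine Finset.card_lt_card ((Finset.ssubset_iff_of_subset fun y hy => ?_).2 ?_)
  · rw [Finset.mem_filter] at hy ⊢
    exact ⟨hy.1, hPQ y hy.1 hy.2⟩
  · exact ⟨x, Finset.mem_filter.mpr ⟨hx, hQx⟩, fun h => hPx (Finset.mem_filter.mp h).2⟩

/-- The scanning recursion behind `block_select`: fuel `n` bounds the number of elements of `T`
strictly below the scan pointer `p`; `b` is the current block end (external gap `≥ θ j`), and the
potential bound `(b - p) + #{u ∈ T | u < p} · θ (j+1) ≤ D (j+1)` together with
`j + #{u ∈ T | u < b} ≤ M` is propagated. -/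
private theorem block_select_aux (M : ℕ) (θ D : ℕ → ℤ) (hθ : ∀ j, 0 ≤ θ j)
    (hD : ∀ j, (M : ℤ) * θ (j + 1) ≤ D (j + 1)) (T : Finset ℤ) (hT : T.Nonempty) :
    ∀ (n j : ℕ) (b p : ℤ), b ∈ T → p ≤ b →
      (T.filter (· < p)).card ≤ n →
      j + (T.filter (· < b)).card ≤ M →
      b - p + ((T.filter (· < p)).card : ℤ) * θ (j + 1) ≤ D (j + 1) →
      (∀ u ∈ T, b < u → θ j ≤ u - b) →
      ∃ j' : ℕ, j' ≤ M ∧ ∃ t' ∈ T, t' - T.min' hT ≤ D (j' + 1) ∧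
        ∀ u ∈ T, t' < u → θ j' ≤ u - t' := by
  intro n
  induction n with
  | zero =>
    intro j b p hb _hpb hcp hjM hscan hinv
    by_cases hout : b - T.min' hT ≤ D (j + 1)
    · exact ⟨j, by omega, b, hb, hout, hinv⟩
    · exfalso
      have h0 : 0 ≤ ((T.filter (· < p)).card : ℤ) * θ (j + 1) :=
        mul_nonneg (Nat.cast_nonneg _) (hθ (j + 1))
      have hmp : T.min' hT < p := by
        have hout' := not_le.mp hout
        linarith
      have hne : (T.filter (· < p)).Nonempty :=
        ⟨T.min' hT, Finset.mem_filter.mpr ⟨Finset.min'_mem T hT, hmp⟩⟩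
      have := hne.card_pos
      omega
  | succ n ih =>
    intro j b p hb hpb _hcp hjM hscan hinv
    by_cases hout : b - T.min' hT ≤ D (j + 1)
    · exact ⟨j, by omega, b, hb, hout, hinv⟩
    · have h0 : 0 ≤ ((T.filter (· < p)).card : ℤ) * θ (j + 1) :=
        mul_nonneg (Nat.cast_nonneg _) (hθ (j + 1))
      have hmp : T.min' hT < p := by
        have hout' := not_le.mp hout
        linarith
      have hne : (T.filter (· < p)).Nonempty :=
        ⟨T.min' hT, Finset.mem_filter.mpr ⟨Finset.min'_mem T hT, hmp⟩⟩
      -- the predecessor `q` of `p` in `T`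
      obtain ⟨q, hqT, hqp, hq_max⟩ : ∃ q ∈ T, q < p ∧ ∀ u ∈ T, u < p → u ≤ q := by
        refine ⟨(T.filter (· < p)).max' hne, (Finset.mem_filter.mp (Finset.max'_mem _ hne)).1,
          (Finset.mem_filter.mp (Finset.max'_mem _ hne)).2, fun u hu hup => ?_⟩
        exact Finset.le_max' _ u (Finset.mem_filter.mpr ⟨hu, hup⟩)
      have hqb : q < b := lt_of_lt_of_le hqp hpb
      have hcq_lt : (T.filter (· < q)).card < (T.filter (· < p)).card :=
        card_filter_lt_card_filter T (· < q) (· < p) (fun x _ hx => lt_trans hx hqp) q hqT hqp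
          (lt_irrefl q)
      have hcq_le : (T.filter (· < q)).card ≤ n := by omega
      by_cases hgap : θ (j + 1) ≤ p - q
      · -- a gap of size `≥ θ (j+1)` just below `p`: descend one level with block end `q`
        have hcqb : (T.filter (· < q)).card < (T.filter (· < b)).card :=
          card_filter_lt_card_filter T (· < q) (· < b) (fun x _ hx => lt_trans hx hqb) q hqT hqb
            (lt_irrefl q)
        refine ih (j + 1) q q hqT le_rfl hcq_le (by omega) ?_ ?_
        · have h1 : ((T.filter (· < q)).card : ℤ) ≤ M := by
            have h1' : (T.filter (· < q)).card ≤ M := by omega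
            exact_mod_cast h1'
          have h2 := mul_le_mul_of_nonneg_right h1 (hθ (j + 1 + 1))
          have h3 := hD (j + 1)
          linarith
        · intro u hu hqu
          have hpu : p ≤ u := not_lt.mp fun h => (not_le.mpr hqu) (hq_max u hu h)
          linarith
      · -- no gap yet: move the scan pointer down to `q`
        have hgap' := not_le.mp hgap
        refine ih j b q hb hqb.le hcq_le hjM ?_ hinv
        have hc : ((T.filter (· < q)).card : ℤ) + 1 ≤ (T.filter (· < p)).card := by
          exact_mod_cast hcq_lt
        have hmul := mul_le_mul_of_nonneg_right hc (hθ (j + 1))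
        have hex : (((T.filter (· < q)).card : ℤ) + 1) * θ (j + 1)
            = ((T.filter (· < q)).card : ℤ) * θ (j + 1) + θ (j + 1) := add_one_mul _ _
        linarith

/-- **Multiscale block selection** (registered stub `block_select` of line `Sketch`).  For thresholds
`θ j ≥ 0` and diameter bounds `D (j+1) ≥ M · θ (j+1)`, every nonempty `T : Finset ℤ` with at most
`M + 1` elements admits a level `j ≤ M` and a block end `t' ∈ T` with `t' - min T ≤ D (j+1)` such that
every element of `T` beyond `t'` is at least `θ j` away.  (The antitonicity hypothesis is unused.) -/
theorem block_select : ∀ (M : ℕ) (θ D : ℕ → ℤ), (∀ j, θ (j + 1) ≤ θ j) → (∀ j, 0 ≤ θ j) →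
    (∀ j, (M : ℤ) * θ (j + 1) ≤ D (j + 1)) → ∀ (T : Finset ℤ) (hT : T.Nonempty),
    T.card ≤ M + 1 → ∃ j : ℕ, j ≤ M ∧ ∃ t' ∈ T, t' - T.min' hT ≤ D (j + 1) ∧
    ∀ u ∈ T, t' < u → θ j ≤ u - t' := by
  intro M θ D _ hθ hD T hT hcard
  have hb : T.max' hT ∈ T := Finset.max'_mem T hT
  have hlt : (T.filter (· < T.max' hT)).card < T.card :=
    Finset.card_lt_card (Finset.filter_ssubset.mpr ⟨T.max' hT, hb, lt_irrefl _⟩)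
  have hcM : (T.filter (· < T.max' hT)).card ≤ M := by omega
  refine block_select_aux M θ D hθ hD T hT (T.filter (· < T.max' hT)).card 0 (T.max' hT)
    (T.max' hT) hb le_rfl le_rfl (by omega) ?_ ?_
  · have h1 : ((T.filter (· < T.max' hT)).card : ℤ) ≤ M := by exact_mod_cast hcM
    have h2 := mul_le_mul_of_nonneg_right h1 (hθ (0 + 1))
    have h3 := hD 0
    linarith
  · intro u hu hbu
    exact absurd hbu (not_lt.mpr (Finset.le_max' T u hu))

end Summit.CriticalPhenomena.CardyFormulaZ2.Cruxes.HalfPlaneMarkDensityLaw.SketchLine.SelfDual
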